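import Summits.BirchSwinnertonDyer.BirchSwinnertonDyer.Theorems.CMKolyvaginAtInertTwoCMKolyvaginConjectureAtInertTwoShallowTwistCoordinates
import Summits.BirchSwinnertonDyer.BirchSwinnertonDyer.Theorems.CMKolyvaginAtInertTwoCMKolyvaginConjectureAtInertTwoGenusTwistHabitat
import Summits.BirchSwinnertonDyer.BirchSwinnertonDyer.Theorems.CMKolyvaginAtInertTwoCMKolyvaginConjectureAtInertTwoPositiveDepthDatumFreeAllLevels
import Literature.NumberTheory.EllipticCurves.RingClassFieldTower
import Literature.NumberTheory.EllipticCurves.RingClassFieldGenusProofs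
import HarnessLib

/-!
# Crux `CMKolyvaginConjectureAtInertTwo` (stmt-BirchSwinnertonDyer-24648), open stub `stub_positiveDepth`:
# the twist dictionary at EVERY square-free CM-inert Kolyvagin level `n` on H₂ —
# `P(n) ∈ 2E(K[n])` iff the genus trace is twice the transport of a `K[1]`-point of the twist `E^{(n*)}`, `n* = ∏_{ℓ∣n} ℓ*`

Route `CMKolyvaginAtInertTwo` (cell `pub/bsd-eis`, seat `leafhand-bsd-cmkolyvaginatinert-3` g0); helper (`--supports
stmt-BirchSwinnertonDyer-24648 --as helper`). THEOREMS ONLY (no definition, no named fact, no `sorry`); closes nothing.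

The predecessor's HABITAT theorem (p803331 `two_dvd_derivedPoint_iff_exists_forall_anti`): on H₂, at every square-free level
`n` of CM-inert Zhang–Kolyvagin primes (any depth) and any datum `d`, `P_d(n) ∈ 2E(K[n]) ⟺ ∃ Q, (∀ ℓ ∣ n, σ_ℓ²Q = Q ∧
σ_ℓQ = −Q) ∧ 2Q = G_d`, `G_d = Σ_{s∈S} s(𝒩_n y(n))` the genus trace. The seat's prime-level dictionary
(`…ShallowTwistCoordinates`) is extended here to every such `n`:

* §1 `coe_mem_ringClassField_of_forall_mem_ringClassGalOver` — Galois correspondence in the tree's coordinates: an element of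
  `K[n]` fixed by `Gal(K[n]/K[m])` (the tree's `ringClassGalOver ι n m`) lies in `K[m]` (as a complex number); with
  `GenusKoly.mem_foldr_span_of_mem_ringClassGalOver_one` (`G_n = ∏ ⟨σ_ℓ⟩`): **fixed by every `σ_ℓ`, `ℓ ∣ n` ⟺ in `K[1]`**
  (`forall_σ_apply_eq_self_iff_coe_mem_ringClassField_one`).
* §2 `exists_sqrt_family` — for every `ℓ ∣ n` a square root `θ_ℓ ∈ K[n]` of `ℓ*` with **`σ_ℓ θ_ℓ = −θ_ℓ` and `σ_{ℓ'} θ_ℓ = θ_ℓ`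
  (`ℓ' ≠ ℓ`)** (`√ℓ* ∈ K[ℓ] ⊆ K[n/ℓ'] ⊆ K[n]`, tree `ringClassField_mono`; `√ℓ* ∉ K[n/ℓ]`, tree
  `sqrt_intCast_not_mem_ringClassField`); hence `Θ = ∏_{ℓ∣n} θ_ℓ ≠ 0` with `σ_ℓ Θ = −Θ` for all `ℓ ∣ n` and `Θ² = n*`
  (`exists_prod_sqrt`).
* §3 `forall_anti_iff_twistCoords_mem` — for an affine `Q = (x, y) ∈ E(K[n])`: `(∀ ℓ ∣ n, σ_ℓ Q = −Q)` iff `x ∈ K[1]` and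
  `w = (2y + a₁x + a₃)/Θ ∈ K[1]`; and `n*·w² = 4x³ + b₂x² + 2b₄x + b₆` (`twist_equation`).
* §4 `two_dvd_derivedPoint_iff_exists_twistCoords_allLevels` — **on H₂, at every admissible level: `P_d(n) ∈ 2E(K[n])` iff
  `G_d = 2Q` with `Q = O` or `Q = (x, (Θw − a₁x − a₃)/2)`, `x, w ∈ K[1]`, `n*w² = 4x³ + b₂x² + 2b₄x + b₆`** — and `G_d`
  itself has twist coordinates in `K[1]` (`genusTrace_twistCoords_mem`). So the open content of crux 24648 (GT∀ of the
  censuses) reads, level by level and at any depth: the genus trace, a `K[1]`-point of the twist `E^{(n*)}` transported to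
  `E(K[1](√n*…))`, is not twice such a point.

HONEST FRAMING: Galois bookkeeping + coordinate algebra on tree theorems; the non-vanishing is untouched; no stub or item is
closed; BSD is proved for no curve. Beyond-print theorem: no.

References: [cite: Cox2013, §9.A, Thm. 9.18, Thm. 8.10, Thm. 11.1] [cite: GrossLMS1991, §3 (G_n ≃ ∏ G_ℓ, (3.5)), §4 (4.1)]
[cite: SilvermanAEC2009, X.2 Prop. 2.4, X.5 Cor. 5.4] [cite: WZhang2014, §3.7].
-/

set_option linter.dupNamespace false -- `Summit.BirchSwinnertonDyer.BirchSwinnertonDyer.Theorems.…` (summit = sub)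
set_option autoImplicit false

noncomputable section

open scoped Classical

namespace Summit.BirchSwinnertonDyer.BirchSwinnertonDyer.Theorems.CMKolyvaginConjecturePositiveDepth

open Finset WeierstrassCurve NumberField Literature.NumberTheory.EllipticCurves
  Literature.NumberTheory.EllipticCurves.ModularForms
  Literature.NumberTheory.EllipticCurves.Rank1Residual

variable {K : Type} [Field K] [NumberField K]

/-! ## §1 Galois correspondence in ring-class coordinates -/

/-- **An element of `K[n]` fixed by `Gal(K[n]/K[m])` lies in `K[m]`** (`K` imaginary quadratic, `n ≠ 0`; the tree's
`ringClassGalOver ι n m` is the subgroup of `Aut_ℚ(K[n])` fixing the elements of `K[n]` that lie in `K[m]`): the Galois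
correspondence for the Galois extension `K[n]/K` (tree `finiteDimensional_and_isGalois_ringClassField`) applied to the
intermediate field `{x ∈ K[n] : x ∈ K[m]}`. [cite: Cox2013, §9.A, Thm. 11.1] -/
theorem coe_mem_ringClassField_of_forall_mem_ringClassGalOver (hK : IsImaginaryQuadratic K) (ι : K →+* ℂ) {n : ℕ}
    (hn : n ≠ 0) (m : ℕ) (x : ringClassField K ι n)
    (h : ∀ g ∈ ringClassGalOver ι n m, g x = x) : (x : ℂ) ∈ ringClassField K ι m := by
  haveI := (finiteDimensional_and_isGalois_ringClassField hK ι hn).1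
  haveI := (finiteDimensional_and_isGalois_ringClassField hK ι hn).2
  let S : Subfield (ringClassField K ι n) := Subfield.comap (ringClassField K ι n).subtype (ringClassField K ι m)
  have hSmem : ∀ y : ringClassField K ι n, y ∈ S ↔ (y : ℂ) ∈ ringClassField K ι m := fun y ↦ Iff.rfl
  let M : IntermediateField K (ringClassField K ι n) := S.toIntermediateField fun k ↦ (hSmem _).mpr (by
    rw [coe_algebraMap_ringClassField]
    exact apply_mem_ringClassField ι m k)
  have hMmem : ∀ y : ringClassField K ι n, y ∈ M ↔ (y : ℂ) ∈ ringClassField K ι m := fun y ↦ Iff.rfl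
  rw [← hMmem, ← IsGalois.fixedField_fixingSubgroup M, IntermediateField.mem_fixedField_iff]
  intro τ hτ
  have hτ' : τ.restrictScalars ℚ ∈ ringClassGalOver ι n m := by
    rw [ringClassGalOver, mem_fixingSubgroup_iff]
    intro y hy
    rw [AlgEquiv.smul_def, AlgEquiv.restrictScalars_apply]
    exact (IntermediateField.mem_fixingSubgroup_iff M τ).mp hτ y ((hMmem y).mpr hy)
  have := h _ hτ'
  rwa [AlgEquiv.restrictScalars_apply] at this

/-- Elements of `K[m]` (inside `K[n]`) are fixed by `Gal(K[n]/K[m])`. [folklore] -/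
theorem apply_eq_self_of_mem_ringClassGalOver {ι : K →+* ℂ} {n m : ℕ} {g : ringClassField K ι n ≃ₐ[ℚ] ringClassField K ι n}
    (hg : g ∈ ringClassGalOver ι n m) {x : ringClassField K ι n} (hx : (x : ℂ) ∈ ringClassField K ι m) : g x = x := by
  rw [ringClassGalOver, mem_fixingSubgroup_iff] at hg
  simpa only [AlgEquiv.smul_def] using hg x hx

/-- An element fixed by every `σ ℓ`, `ℓ ∈ L`, is fixed by every product `∏ σ_ℓ^{i_ℓ}` in the span of `L`. [folklore] -/
theorem apply_eq_self_of_mem_foldr_span {F : Type} [Field F] [Algebra ℚ F] (σ : ℕ → (F ≃ₐ[ℚ] F)) (x : F)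
    (L : List ℕ) (hfix : ∀ ℓ ∈ L, σ ℓ x = x) {g : F ≃ₐ[ℚ] F}
    (hg : g ∈ L.foldr (fun ℓ T ↦ (range (ℓ + 1) ×ˢ T).image (fun p ↦ σ ℓ ^ p.1 * p.2)) {1}) : g x = x := by
  induction L generalizing g with
  | nil =>
    simp only [List.foldr_nil, Finset.mem_singleton] at hg
    rw [hg]
    rfl
  | cons q L ih =>
    rw [List.foldr_cons, Finset.mem_image] at hg
    obtain ⟨⟨i, z⟩, hmem, rfl⟩ := hg
    have hz : z x = x := ih (fun ℓ hℓ ↦ hfix ℓ (List.mem_cons_of_mem q hℓ)) (Finset.mem_product.mp hmem).2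
    have hq : σ q x = x := hfix q List.mem_cons_self
    have hpow : (σ q ^ i) x = x := by
      have hstab : σ q ∈ MulAction.stabilizer (F ≃ₐ[ℚ] F) x := hq
      have := Subgroup.pow_mem _ hstab i
      rwa [MulAction.mem_stabilizer_iff] at this
    rw [AlgEquiv.mul_apply, hz, hpow]

/-- **Fixed by every Kolyvagin generator ⟺ in `K[1]`.** For `K` imaginary quadratic with odd `d_K ≠ −3`, `n` square-free with
every prime factor inert in `K`, a datum `d` of conductor `n`, and `x ∈ K[n]`: `(∀ ℓ ∣ n, σ_ℓ x = x) ⟺ x ∈ K[1]`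
(`G_n = Gal(K[n]/K[1])` is the span of the `σ_ℓ`, `GenusKoly.mem_foldr_span_of_mem_ringClassGalOver_one`; Galois
correspondence §1). [cite: GrossLMS1991, §3 (G_n ≃ ∏ G_ℓ)] [cite: Cox2013, §9.A] -/
theorem forall_σ_apply_eq_self_iff_coe_mem_ringClassField_one (hK : IsImaginaryQuadratic K)
    (hodd : Odd (NumberField.discr K)) (h3 : NumberField.discr K ≠ -3) {N : ℕ} [NeZero N] {W : WeierstrassCurve ℚ}
    {Dt : ModularParametrizationData W N} {β : ℤ} {ι : K →+* ℂ} {n : ℕ} (hn : Squarefree n)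
    (hinert : ∀ ℓ ∈ n.primeFactors, (Ideal.span {(ℓ : 𝓞 K)}).IsPrime) (d : KolyvaginHeegnerData Dt β ι n)
    (x : ringClassField K ι n) :
    (∀ ℓ ∈ n.primeFactors, d.σ ℓ x = x) ↔ (x : ℂ) ∈ ringClassField K ι 1 := by
  constructor
  · intro hfix
    refine coe_mem_ringClassField_of_forall_mem_ringClassGalOver hK ι hn.ne_zero 1 x fun g hg ↦ ?_
    have hspan := GenusKoly.mem_foldr_span_of_mem_ringClassGalOver_one hK ι
      (GenusKoly.discr_lt_neg_four_of_odd hK hodd h3) hn hinert d.zpowers_σ hg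
    exact apply_eq_self_of_mem_foldr_span d.σ x n.primeFactorsList
      (fun ℓ hℓ ↦ hfix ℓ (Nat.mem_primeFactors_iff_mem_primeFactorsList.mpr hℓ)) hspan
  · intro hx ℓ hℓ
    have hσ : d.σ ℓ ∈ ringClassGalOver ι n (n / ℓ) := by
      rw [← d.zpowers_σ ℓ hℓ]
      exact Subgroup.mem_zpowers _
    have hle : ringClassField K ι 1 ≤ ringClassField K ι (n / ℓ) :=
      ringClassField_mono hK ι (one_dvd _) (Nat.div_ne_zero_iff_of_dvd (Nat.dvd_of_mem_primeFactors hℓ) |>.mpr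
        ⟨hn.ne_zero, (Nat.prime_of_mem_primeFactors hℓ).ne_zero⟩)
    exact apply_eq_self_of_mem_ringClassGalOver hσ (hle hx)

/-! ## §2 Square roots `θ_ℓ ∈ K[n]` of `ℓ*` with `σ_ℓ θ_ℓ = −θ_ℓ`, `σ_{ℓ'} θ_ℓ = θ_ℓ` -/

set_option maxHeartbeats 400000 in
/-- **The genus square roots at level `n`.** `K` imaginary quadratic, `n` square-free, every prime factor odd and prime to
`d_K` (e.g. Zhang–Kolyvagin primes), `d` a datum of conductor `n`: for every `ℓ ∣ n` there is `θ ∈ K[n]` with `θ² = ℓ*`,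
`θ ≠ 0`, `σ_ℓ θ = −θ` and `σ_{ℓ'} θ = θ` for every other prime `ℓ' ∣ n`. (`√ℓ* ∈ K[ℓ] ⊆ K[n]`, and `⊆ K[n/ℓ']` for `ℓ' ≠ ℓ`,
fixed by `Gal(K[n]/K[n/ℓ']) ∋ σ_{ℓ'}`; `σ_ℓ θ = ±θ`, and `+` would put `√ℓ*` in `K[n/ℓ]`, where it is not since `ℓ ∤ n/ℓ`.)
[cite: Cox2013, Thm. 9.18, Thm. 8.10, §9.A] [cite: SilvermanAEC2009, X.2 Prop. 2.4 (proof)] -/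
theorem exists_sqrt_family (hK : IsImaginaryQuadratic K) {N : ℕ} [NeZero N] {W : WeierstrassCurve ℚ}
    {Dt : ModularParametrizationData W N} {β : ℤ} {ι : K →+* ℂ} {n : ℕ} (hn : Squarefree n)
    (hodd' : ∀ ℓ ∈ n.primeFactors, ℓ ≠ 2) (hdK : ∀ ℓ ∈ n.primeFactors, ¬ ((ℓ : ℤ) ∣ NumberField.discr K))
    (d : KolyvaginHeegnerData Dt β ι n) {ℓ : ℕ} (hℓ : ℓ ∈ n.primeFactors) :
    ∃ θ : ringClassField K ι n, θ ^ 2 = algebraMap ℚ (ringClassField K ι n) ((-1 : ℚ) ^ (ℓ / 2) * ℓ) ∧ θ ≠ 0 ∧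
      d.σ ℓ θ = -θ ∧ ∀ ℓ' ∈ n.primeFactors, ℓ' ≠ ℓ → d.σ ℓ' θ = θ := by
  have hn0 : n ≠ 0 := hn.ne_zero
  have hℓP : ℓ.Prime := Nat.prime_of_mem_primeFactors hℓ
  have hℓn : ℓ ∣ n := Nat.dvd_of_mem_primeFactors hℓ
  obtain ⟨θ₀, hθ₀2, -, -, -⟩ := sqrt_pStar_mem_ringClassField_holds K hK ι ℓ hℓP (hodd' ℓ hℓ) (hdK ℓ hℓ)
  have hle : ringClassField K ι ℓ ≤ ringClassField K ι n := ringClassField_mono hK ι hℓn hn0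
  set θ : ringClassField K ι n := ⟨(θ₀ : ℂ), hle θ₀.2⟩ with hθ_def
  have hθ2 : θ ^ 2 = algebraMap ℚ (ringClassField K ι n) ((-1 : ℚ) ^ (ℓ / 2) * ℓ) := by
    apply Subtype.ext
    have h := congrArg (fun z : ringClassField K ι ℓ ↦ (z : ℂ)) hθ₀2
    simp only [SubmonoidClass.coe_pow, eq_ratCast, SubfieldClass.coe_ratCast] at h ⊢
    exact h
  have hθ : θ ≠ 0 := ne_zero_of_sq_eq_pStar hℓP hθ2
  -- the complex number `θ₀` is a square root of the integer `ℓ*`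
  have hr : ((θ : ringClassField K ι n) : ℂ) ^ 2 = (((-1) ^ (ℓ / 2) * (ℓ : ℤ) : ℤ) : ℂ) := by
    have h := congrArg (fun z : ringClassField K ι n ↦ (z : ℂ)) hθ2
    simp only [SubmonoidClass.coe_pow, eq_ratCast, SubfieldClass.coe_ratCast] at h
    rw [h]
    push_cast
    ring
  refine ⟨θ, hθ2, hθ, ?_, fun ℓ' hℓ' hne ↦ ?_⟩
  · -- `σ_ℓ θ = −θ`
    rcases algEquiv_apply_eq_or_eq_neg_of_sq_eq hθ2 (d.σ ℓ) with hfix | hneg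
    · exfalso
      -- every element of `Gal(K[n]/K[n/ℓ]) = ⟨σ_ℓ⟩` fixes `θ`, so `θ ∈ K[n/ℓ]`
      have hmem : (θ : ℂ) ∈ ringClassField K ι (n / ℓ) := by
        refine coe_mem_ringClassField_of_forall_mem_ringClassGalOver hK ι hn0 (n / ℓ) θ fun g hg ↦ ?_
        rw [← d.zpowers_σ ℓ hℓ] at hg
        obtain ⟨k, rfl⟩ := Subgroup.mem_zpowers_iff.mp hg
        have hstab : d.σ ℓ ∈ MulAction.stabilizer (ringClassField K ι n ≃ₐ[ℚ] ringClassField K ι n) θ := hfix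
        have := Subgroup.zpow_mem _ hstab k
        rwa [MulAction.mem_stabilizer_iff] at this
      have hℓnℓ : ¬ ℓ ∣ n / ℓ := fun h ↦ by
        have : ℓ * ℓ ∣ n := by
          have := Nat.mul_dvd_mul_left ℓ h
          rwa [Nat.mul_div_cancel' hℓn] at this
        exact hℓP.not_isUnit (hn ℓ this)
      have hdiv0 : n / ℓ ≠ 0 := (Nat.div_ne_zero_iff_of_dvd hℓn).mpr ⟨hn0, hℓP.ne_zero⟩
      have hsq : ¬ (ℓ : ℤ) ^ 2 ∣ (-1) ^ (ℓ / 2) * (ℓ : ℤ) := by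
        intro h
        have h' : (ℓ : ℤ) ^ 2 ∣ (ℓ : ℤ) := by
          have hu : IsUnit ((-1 : ℤ) ^ (ℓ / 2)) := (isUnit_neg_one (α := ℤ)).pow _
          exact (hu.dvd_mul_left).mp h
        have hℓ1 : (ℓ : ℤ) ^ 2 ≤ ℓ := Int.le_of_dvd (by exact_mod_cast hℓP.pos) h'
        have := hℓP.two_le
        nlinarith
      exact sqrt_intCast_not_mem_ringClassField hK ι hdiv0 hℓP (Dvd.intro_left _ rfl) hsq hℓnℓ (hdK ℓ hℓ)
        (θ : ℂ) hr hmem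
    · exact hneg
  · -- `σ_{ℓ'} θ = θ`: `θ ∈ K[ℓ] ⊆ K[n/ℓ']`, fixed by `Gal(K[n]/K[n/ℓ']) ∋ σ_{ℓ'}`
    have hℓ'P : ℓ'.Prime := Nat.prime_of_mem_primeFactors hℓ'
    have hℓ'n : ℓ' ∣ n := Nat.dvd_of_mem_primeFactors hℓ'
    have hdiv0 : n / ℓ' ≠ 0 := (Nat.div_ne_zero_iff_of_dvd hℓ'n).mpr ⟨hn0, hℓ'P.ne_zero⟩
    have hℓdiv : ℓ ∣ n / ℓ' := by
      have hcop : Nat.Coprime ℓ ℓ' := (Nat.coprime_primes hℓP hℓ'P).mpr hne.symm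
      obtain ⟨c, hc⟩ := hℓ'n
      rw [hc, Nat.mul_div_cancel_left _ hℓ'P.pos]
      rw [hc] at hℓn
      exact hcop.dvd_of_dvd_mul_left hℓn
    have hle' : ringClassField K ι ℓ ≤ ringClassField K ι (n / ℓ') := ringClassField_mono hK ι hℓdiv hdiv0
    have hσ : d.σ ℓ' ∈ ringClassGalOver ι n (n / ℓ') := by
      rw [← d.zpowers_σ ℓ' hℓ']
      exact Subgroup.mem_zpowers _
    exact apply_eq_self_of_mem_ringClassGalOver hσ (hle' θ₀.2)

/-- **The product root `Θ = ∏_{ℓ∣n} θ_ℓ`**: same frame; there is `Θ ∈ K[n]`, `Θ ≠ 0`, with `σ_ℓ Θ = −Θ` for every `ℓ ∣ n`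
and `Θ² = n* := ∏_{ℓ∣n} ℓ*`. [cite: Cox2013, §9.A, Thm. 9.18] [cite: GrossLMS1991, §3] -/
theorem exists_prod_sqrt (hK : IsImaginaryQuadratic K) {N : ℕ} [NeZero N] {W : WeierstrassCurve ℚ}
    {Dt : ModularParametrizationData W N} {β : ℤ} {ι : K →+* ℂ} {n : ℕ} (hn : Squarefree n)
    (hodd' : ∀ ℓ ∈ n.primeFactors, ℓ ≠ 2) (hdK : ∀ ℓ ∈ n.primeFactors, ¬ ((ℓ : ℤ) ∣ NumberField.discr K))
    (d : KolyvaginHeegnerData Dt β ι n) :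
    ∃ Θ : ringClassField K ι n,
      Θ ^ 2 = algebraMap ℚ (ringClassField K ι n) (∏ ℓ ∈ n.primeFactors, ((-1 : ℚ) ^ (ℓ / 2) * ℓ)) ∧ Θ ≠ 0 ∧
      ∀ ℓ ∈ n.primeFactors, d.σ ℓ Θ = -Θ := by
  choose! θ hθ2 hθ0 hθneg hθfix using fun ℓ (hℓ : ℓ ∈ n.primeFactors) ↦ exists_sqrt_family hK hn hodd' hdK d hℓ
  refine ⟨∏ ℓ ∈ n.primeFactors, θ ℓ, ?_, ?_, fun ℓ hℓ ↦ ?_⟩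
  · rw [← Finset.prod_pow, map_prod]
    exact Finset.prod_congr rfl fun ℓ hℓ ↦ hθ2 ℓ hℓ
  · exact Finset.prod_ne_zero_iff.mpr fun ℓ hℓ ↦ hθ0 ℓ hℓ
  · rw [map_prod, ← Finset.mul_prod_erase _ (fun ℓ' ↦ d.σ ℓ (θ ℓ')) hℓ, ← Finset.mul_prod_erase _ θ hℓ, hθneg ℓ hℓ,
      neg_mul]
    congr 2
    exact Finset.prod_congr rfl fun ℓ' hℓ' ↦
      hθfix ℓ' (Finset.mem_of_mem_erase hℓ') ℓ hℓ (Finset.ne_of_mem_erase hℓ').symm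

/-! ## §3 The coordinate dictionary at level `n` -/

/-- **All-`σ_ℓ`-anti-invariant affine points = `K[1]`-points of the twist by `Θ²`.** `K` imaginary quadratic with odd
`d_K ≠ −3`, `n` square-free with prime factors inert in `K`, `d` a datum of conductor `n`, `Θ ∈ K[n]`, `Θ ≠ 0` with
`σ_ℓ Θ = −Θ` for all `ℓ ∣ n` (§2); for an affine point `(x, y) ∈ E(K[n])`:
`(∀ ℓ ∣ n, σ_ℓ(x, y) = −(x, y)) ⟺ x ∈ K[1] ∧ (2y + a₁x + a₃)/Θ ∈ K[1]`.
[cite: SilvermanAEC2009, X.2 Prop. 2.4 (proof), X.5 Cor. 5.4] [cite: GrossLMS1991, §3 (G_n ≃ ∏ G_ℓ)] -/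
theorem forall_anti_iff_twistCoords_mem (hK : IsImaginaryQuadratic K) (hodd : Odd (NumberField.discr K))
    (h3 : NumberField.discr K ≠ -3) (W : WeierstrassCurve ℚ) {N : ℕ} [NeZero N]
    {Dt : ModularParametrizationData W N} {β : ℤ} {ι : K →+* ℂ} {n : ℕ} (hn : Squarefree n)
    (hinert : ∀ ℓ ∈ n.primeFactors, (Ideal.span {(ℓ : 𝓞 K)}).IsPrime) (d : KolyvaginHeegnerData Dt β ι n)
    {Θ : ringClassField K ι n} (hΘ : Θ ≠ 0) (hΘneg : ∀ ℓ ∈ n.primeFactors, d.σ ℓ Θ = -Θ)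
    {x y : ringClassField K ι n} (h : (W.baseChange (ringClassField K ι n)).toAffine.Nonsingular x y) :
    (∀ ℓ ∈ n.primeFactors, pointGalHom W (ringClassField K ι n) (d.σ ℓ) (.some x y h) = -(.some x y h)) ↔
      ((x : ℂ) ∈ ringClassField K ι 1 ∧
        (((2 * y + (W.baseChange (ringClassField K ι n)).toAffine.a₁ * x +
            (W.baseChange (ringClassField K ι n)).toAffine.a₃) / Θ : ringClassField K ι n) : ℂ) ∈
          ringClassField K ι 1) := by
  rw [← forall_σ_apply_eq_self_iff_coe_mem_ringClassField_one hK hodd h3 hn hinert d x,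
    ← forall_σ_apply_eq_self_iff_coe_mem_ringClassField_one hK hodd h3 hn hinert d
      ((2 * y + (W.baseChange (ringClassField K ι n)).toAffine.a₁ * x +
        (W.baseChange (ringClassField K ι n)).toAffine.a₃) / Θ)]
  constructor
  · intro hanti
    have hc : ∀ ℓ ∈ n.primeFactors, d.σ ℓ x = x ∧
        d.σ ℓ ((2 * y + (W.baseChange (ringClassField K ι n)).toAffine.a₁ * x +
          (W.baseChange (ringClassField K ι n)).toAffine.a₃) / Θ) =
          (2 * y + (W.baseChange (ringClassField K ι n)).toAffine.a₁ * x +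
            (W.baseChange (ringClassField K ι n)).toAffine.a₃) / Θ := fun ℓ hℓ ↦
      (anti_iff_fixed_coords W (d.σ ℓ) hΘ (hΘneg ℓ hℓ) x y).mp
        ((pointGalHom_some_eq_neg_iff W (d.σ ℓ) h).mp (hanti ℓ hℓ))
    exact ⟨fun ℓ hℓ ↦ (hc ℓ hℓ).1, fun ℓ hℓ ↦ (hc ℓ hℓ).2⟩
  · rintro ⟨hx, hw⟩ ℓ hℓ
    exact (pointGalHom_some_eq_neg_iff W (d.σ ℓ) h).mpr
      ((anti_iff_fixed_coords W (d.σ ℓ) hΘ (hΘneg ℓ hℓ) x y).mpr ⟨hx ℓ hℓ, hw ℓ hℓ⟩)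

/-! ## §4 On H₂: the crux's clause at every admissible level in twist coordinates -/

/-- **`Θ` for a square-free CM-inert Kolyvagin level** (§2 with the hypotheses read off `IsKolyvaginPrime`): `Θ ∈ K[n]`,
`Θ² = ∏_{ℓ∣n} ℓ*`, `Θ ≠ 0`, `σ_ℓ Θ = −Θ` for all `ℓ ∣ n`. [cite: Cox2013, §9.A, Thm. 9.18] [cite: WZhang2014, Notations (xii)] -/
theorem exists_prod_sqrt_of_isKolyvaginPrime (hK : IsImaginaryQuadratic K) (W : WeierstrassCurve ℚ) [W.IsGloballyMinimal]
    [NeZero (W.conductorNorm ℤ)] {Dt : ModularParametrizationData W (W.conductorNorm ℤ)} {β : ℤ} {ι : K →+* ℂ} {n : ℕ}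
    (hn : Squarefree n) (hKol : ∀ ℓ ∈ n.primeFactors, Zhang2014.IsKolyvaginPrime (W.conductorNorm ℤ) W K 2 ℓ)
    (d : KolyvaginHeegnerData Dt β ι n) :
    ∃ Θ : ringClassField K ι n,
      Θ ^ 2 = algebraMap ℚ (ringClassField K ι n) (∏ ℓ ∈ n.primeFactors, ((-1 : ℚ) ^ (ℓ / 2) * ℓ)) ∧ Θ ≠ 0 ∧
      ∀ ℓ ∈ n.primeFactors, d.σ ℓ Θ = -Θ :=
  exists_prod_sqrt hK hn (fun ℓ hℓ ↦ (hKol ℓ hℓ).2.2.2.1) (fun ℓ hℓ ↦ (hKol ℓ hℓ).2.2.1) d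

/-- **THE TWIST DICTIONARY AT EVERY LEVEL (H₂).** Frame: `W/ℚ` globally minimal with CM, `2` inert in `F`, `ρ̄_{E,2}` onto;
`K` imaginary quadratic with odd `d_K ≠ −3`, Heegner for `N_E`; `n` square-free with every prime factor a CM-inert
Zhang–Kolyvagin prime at `2` (ANY depth); `d` any datum; `Θ ∈ K[n]`, `Θ ≠ 0`, `σ_ℓΘ = −Θ` for all `ℓ ∣ n` (exists with
`Θ² = n* = ∏ ℓ*`, `exists_prod_sqrt_of_isKolyvaginPrime`). With `G_d = Σ_{s∈S} s(𝒩_n y(n))` the genus trace: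
**`P_d(n) ∈ 2E(K[n])` iff `G_d = 2Q` for some `Q ∈ E(K[n])` which is `O` or affine `(x, y)` with `x ∈ K[1]` and
`(2y + a₁x + a₃)/Θ ∈ K[1]`** — i.e. `Q` is the transport `(x, w) ↦ (x, (Θw − a₁x − a₃)/2)` of a `K[1]`-point `(x, w)` of the
quadratic twist `E^{(n*)} : n*·w² = 4x³ + b₂x² + 2b₄x + b₆` (`twist_equation`). (p803331's habitat theorem + §1–§3.)
[cite: GrossLMS1991, §3 (3.5), Prop. 3.7 (1), §4 (4.1)] [cite: SilvermanAEC2009, X.5 Cor. 5.4] [cite: Cox2013, §9.A] -/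
theorem two_dvd_derivedPoint_iff_exists_twistCoords_allLevels (W : WeierstrassCurve ℚ) [W.IsElliptic]
    [W.IsGloballyMinimal] [NeZero (W.conductorNorm ℤ)] (hCM : W.HasCM) (hin : CMInert W 2)
    (hρ : W.HasSurjectiveModNGaloisRep (2 : ℤ)) (hK : IsImaginaryQuadratic K)
    (hodd : Odd (NumberField.discr K)) (h3 : NumberField.discr K ≠ -3)
    (hH : SatisfiesHeegnerHypothesis (W.conductorNorm ℤ) K)
    {Dt : ModularParametrizationData W (W.conductorNorm ℤ)} {β : ℤ} {ι : K →+* ℂ} {n : ℕ} (hn : Squarefree n)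
    (hKol : ∀ ℓ ∈ n.primeFactors, Zhang2014.IsKolyvaginPrime (W.conductorNorm ℤ) W K 2 ℓ ∧ CMInert W ℓ)
    (d : KolyvaginHeegnerData Dt β ι n) {Θ : ringClassField K ι n} (hΘ : Θ ≠ 0)
    (hΘneg : ∀ ℓ ∈ n.primeFactors, d.σ ℓ Θ = -Θ) :
    (∃ Q : (W.baseChange (ringClassField K ι n)).toAffine.Point, (2 : ℤ) • Q = d.derivedPoint) ↔
      ∃ Q : (W.baseChange (ringClassField K ι n)).toAffine.Point,
        (2 : ℤ) • Q = ∑ s ∈ d.S, pointGalHom W (ringClassField K ι n) s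
            (n.primeFactorsList.foldr
              (fun q x ↦ ∑ k ∈ range ((q + 1) / 2), pointGalHom W (ringClassField K ι n) ((d.σ q ^ 2) ^ k) x) d.y) ∧
        ∀ (x y : ringClassField K ι n) (h : (W.baseChange (ringClassField K ι n)).toAffine.Nonsingular x y),
          Q = .some x y h →
            (x : ℂ) ∈ ringClassField K ι 1 ∧
              (((2 * y + (W.baseChange (ringClassField K ι n)).toAffine.a₁ * x +
                  (W.baseChange (ringClassField K ι n)).toAffine.a₃) / Θ : ringClassField K ι n) : ℂ) ∈
                ringClassField K ι 1 := by
  have hinert : ∀ ℓ ∈ n.primeFactors, (Ideal.span {(ℓ : 𝓞 K)}).IsPrime := fun ℓ hℓ ↦ (hKol ℓ hℓ).1.2.2.2.2.1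
  rw [two_dvd_derivedPoint_iff_exists_forall_anti W hCM hin hρ hK hodd h3 hH hn hKol d]
  constructor
  · rintro ⟨Q, hanti, hQ⟩
    refine ⟨Q, hQ, fun x y h hQe ↦ ?_⟩
    subst hQe
    exact (forall_anti_iff_twistCoords_mem hK hodd h3 W hn hinert d hΘ hΘneg h).mp fun ℓ hℓ ↦ (hanti ℓ hℓ).2
  · rintro ⟨Q, hQ, hcoord⟩
    refine ⟨Q, fun ℓ hℓ ↦ ?_, hQ⟩
    have hanti : pointGalHom W (ringClassField K ι n) (d.σ ℓ) Q = -Q := by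
      rcases Q with _ | ⟨x, y, h⟩
      · exact (map_zero _).trans neg_zero.symm
      · exact (forall_anti_iff_twistCoords_mem hK hodd h3 W hn hinert d hΘ hΘneg h).mpr (hcoord x y h rfl) ℓ hℓ
    refine ⟨?_, hanti⟩
    rw [pow_two, map_mul, AddMonoid.End.coe_mul, Function.comp_apply, hanti, map_neg, hanti, neg_neg]

/-- **The genus trace `G_d` itself is the transport of a `K[1]`-point of `E^{(n*)}`** (same frame): `σ_ℓ G_d = −G_d` for every
`ℓ ∣ n` (p801497 `pointGalHom_σ_genusTrace_eq_neg`), so `G_d = O` or its twist coordinates `x`, `(2y + a₁x + a₃)/Θ` lie in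
`K[1]`. Hence the open clause of crux 24648 at level `n` — `G_d ∉ 2E(K[n])`, equivalently (above) `G_d ∉ 2·ι_Θ(E^{(n*)}(K[1]))`
— is a level-ONE `2`-indivisibility statement about a `K[1]`-point of ONE quadratic twist `E^{(n*)}`, at every depth.
[cite: GrossLMS1991, §3 (3.5), Prop. 3.7 (1), §4 (4.1)] [cite: SilvermanAEC2009, X.5 Cor. 5.4] -/
theorem genusTrace_twistCoords_mem (W : WeierstrassCurve ℚ) [W.IsElliptic] [W.IsGloballyMinimal]
    [NeZero (W.conductorNorm ℤ)] (hCM : W.HasCM) (hK : IsImaginaryQuadratic K)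
    (hodd : Odd (NumberField.discr K)) (h3 : NumberField.discr K ≠ -3)
    (hH : SatisfiesHeegnerHypothesis (W.conductorNorm ℤ) K)
    {Dt : ModularParametrizationData W (W.conductorNorm ℤ)} {β : ℤ} {ι : K →+* ℂ} {n : ℕ} (hn : Squarefree n)
    (hKol : ∀ ℓ ∈ n.primeFactors, Zhang2014.IsKolyvaginPrime (W.conductorNorm ℤ) W K 2 ℓ ∧ CMInert W ℓ)
    (d : KolyvaginHeegnerData Dt β ι n) {Θ : ringClassField K ι n} (hΘ : Θ ≠ 0)
    (hΘneg : ∀ ℓ ∈ n.primeFactors, d.σ ℓ Θ = -Θ) :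
    ∀ (x y : ringClassField K ι n) (h : (W.baseChange (ringClassField K ι n)).toAffine.Nonsingular x y),
      (∑ s ∈ d.S, pointGalHom W (ringClassField K ι n) s
          (n.primeFactorsList.foldr
            (fun q x ↦ ∑ k ∈ range ((q + 1) / 2), pointGalHom W (ringClassField K ι n) ((d.σ q ^ 2) ^ k) x) d.y)) =
        .some x y h →
        (x : ℂ) ∈ ringClassField K ι 1 ∧
          (((2 * y + (W.baseChange (ringClassField K ι n)).toAffine.a₁ * x +
              (W.baseChange (ringClassField K ι n)).toAffine.a₃) / Θ : ringClassField K ι n) : ℂ) ∈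
            ringClassField K ι 1 := by
  have hinert : ∀ ℓ ∈ n.primeFactors, (Ideal.span {(ℓ : 𝓞 K)}).IsPrime := fun ℓ hℓ ↦ (hKol ℓ hℓ).1.2.2.2.2.1
  intro x y h hG
  refine (forall_anti_iff_twistCoords_mem hK hodd h3 W hn hinert d hΘ hΘneg h).mp fun ℓ hℓ ↦ ?_
  rw [← hG]
  exact pointGalHom_σ_genusTrace_eq_neg W hCM hK hodd h3 hH hn hKol d hℓ

/-- **The twist equation at level `n`**: for an affine `(x, y) ∈ E(K[n])` and `Θ² = n*`, `w = (2y + a₁x + a₃)/Θ` satisfies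
`n*·w² = 4x³ + b₂x² + 2b₄x + b₆` (`twist_equation` with `c = n*`). [cite: SilvermanAEC2009, III.1, X.5 Cor. 5.4] -/
theorem twist_equation_allLevels (W : WeierstrassCurve ℚ) {ι : K →+* ℂ} {n : ℕ} {Θ : ringClassField K ι n} (hΘ : Θ ≠ 0)
    (hΘ2 : Θ ^ 2 = algebraMap ℚ (ringClassField K ι n) (∏ ℓ ∈ n.primeFactors, ((-1 : ℚ) ^ (ℓ / 2) * ℓ)))
    {x y : ringClassField K ι n} (h : (W.baseChange (ringClassField K ι n)).toAffine.Equation x y) :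
    algebraMap ℚ (ringClassField K ι n) (∏ ℓ ∈ n.primeFactors, ((-1 : ℚ) ^ (ℓ / 2) * ℓ)) *
        ((2 * y + (W.baseChange (ringClassField K ι n)).toAffine.a₁ * x +
          (W.baseChange (ringClassField K ι n)).toAffine.a₃) / Θ) ^ 2 =
      4 * x ^ 3 + (W.baseChange (ringClassField K ι n)).b₂ * x ^ 2 + 2 * (W.baseChange (ringClassField K ι n)).b₄ * x +
        (W.baseChange (ringClassField K ι n)).b₆ :=
  twist_equation W hΘ hΘ2 h

end Summit.BirchSwinnertonDyer.BirchSwinnertonDyer.Theorems.CMKolyvaginConjecturePositiveDepth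

end
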